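import Summits.BirchSwinnertonDyer.Rank1Residual.Additive.GoodModelReductionLine
import Summits.BirchSwinnertonDyer.Rank1Residual.Additive.GordHigherOrdinaryPoint
import Summits.BirchSwinnertonDyer.Rank1Residual.Additive.GoodModelOfTypeG
import Summits.BirchSwinnertonDyer.Rank1Residual.Additive.GordRamifiedOrdinaryLine
import Summits.BirchSwinnertonDyer.Rank1Residual.Additive.TypeGRamification
import Summits.BirchSwinnertonDyer.Rank1Residual.Additive.TypeGIntegralJ
import Summits.BirchSwinnertonDyer.Rank1Residual.Additive.TypeGThree
import Summits.BirchSwinnertonDyer.Rank1Residual.Additive.RamifiedOrdinaryLineUniqueModelFree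
import HarnessLib

/-!
# T-ROL-G F-C: the RAMIFIED ORDINARY LINE on EVERY X4♯(G-ord) / X3♯(G-ord) row — the defect binder
# `he : semistabilityIndex W p = 2` of p10's `ClassX4Gord.exists_isRamifiedOrdinaryLine` REMOVED
# (team n1011, row T-ROL-G; seat p05 GEN 5; lead R5-57; referee-1 ACK-1 GEN 16)

HONEST FRAMING (cell `b2b-bsdres`, run/shared/lean/b2b/bsd-rank1-residual/, verbatim in every
file): the goal of the cell is to DELETE the COMBINATION-SHAPED residual classes of the
Birch–Swinnerton-Dyer formula for ALL analytic-rank `≤ 1` elliptic curves over `ℚ` — "full BSD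
formula for every rank `≤ 1` curve in class `C`" assembled STRICTLY from published theorems — so
that the rank-`≤ 1` remainder becomes exactly the CONSTRUCTION-SHAPED classes, which are TYPED
(missing-input `Prop`s), NOT attempted. This is not "finishing BSD". Team n1011 (N10/N11): research
route on the CONSTRUCTION-SHAPED classes X3♯(G-ord)/X4♯(G-ord); prove what is provable now; no
claim beyond stated classes; census output = EVIDENCE, never a Literature fact; RESIDUAL-MAP marks
UNCHANGED; nothing is booked by this file. Assembly theorems only: NO definition, NO named fact,
NO conjecture node.

## What and why

p10's TB-ROL FILE B (`Additive/GordRamifiedOrdinaryLine.lean`, p259355) proves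
`ClassX4Gord.exists_isRamifiedOrdinaryLine (hX) (he : semistabilityIndex W p = 2) (hpv)`: the line
is Greenberg's `C_v(V)` of a `ℚ`-MODEL `V` of the `p*`-twist, available only on Kodaira `I₀*`
(`e = 2`). On the N10 cell `CellGordHigher` (`e ∈ {3, 4, 6}`, `p ≥ 5`, `p ≡ 1 (mod e)`; 4 073 of
the 111 994 N10 cells, plus the O7 share) no curve over `ℚ` plays `V` and the class file of record
has "Gord_e346: line existence / R-D untyped; R3″ NO kernel consumer"
(class-closure/N10/WEEK-2026-08-28-INPUT-typer2 §2/§3/§5). This file closes the EXISTENCE half on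
those rows by the row's good-model construction (files F-A1/F-A2/F-A3
`GoodModelReductionKernel/Datum/Line`, F-B `GordHigherOrdinaryPoint`):

* §1 `valuation_le_one_iff_padicValRat`, `specVal_algebraMap_rat_iff` — `ord_p` of a rational
  number versus the place `v ∋ p` and the spectral valuation of `K̄_v` (bookkeeping).
* §2 `exists_goodModel_of_padicValRat_j_nonneg` — a GOOD MODEL `W₀ = C • E ⊗ K̄_v` over
  `𝒪_w ⊂ K̄_v` from `ord_p j ≥ 0`, `p ≠ 3` (the tree's Deuring form
  `exists_variableChange_eq_baseChange_isUnit_Δ_of_val_j_le_one`, *AEC* VII.5.5 / App. A 1.3);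
  `goodModel_j` (`j(W₀) = j(E)`), `residue_c₄_eq_zero_of_goodModel` (`ord_p j > 0` or `j = 0` ⟹
  `c̃₄ = 0`, i.e. `j̃ = 0`), `residue_c₆_eq_zero_of_goodModel` (`ord_p (j − 1728) > 0` or
  `j = 1728` ⟹ `c̃₆ = 0`, i.e. `j̃ = 1728`).
* §3 **`exists_isRamifiedOrdinaryLine_of_typeGOrd_of_semistabilityIndex_ne_two (hp5 hG hadd he hpv)`**
  — `TypeGOrd W p ∧ Addv W p ∧ e_E(p) ≠ 2 ∧ p ≥ 5 ⟹ ∃ L, IsRamifiedOrdinaryLine W p L`: from (G),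
  `ord_p j ≥ 0` (`padicValRat_j_nonneg_of_typeGOrd`) and `e ∣ p − 1`
  (`typeG_iff_not_subM_and_semistabilityIndex_dvd`); `e ≠ 1` at an additive prime
  (`semistabilityIndex_ne_one_of_addv`), so `e ∈ {3, 4, 6, 12}`; `3 ∣ e` gives `j ≡ 0`
  (`j_eq_zero_or_padicValRat_j_pos_of_not_three_dvd`) and `3 ∣ p − 1`, `4 ∣ e` gives `j ≡ 1728`
  (`j_eq_or_padicValRat_j_sub_pos_of_not_two_dvd`) and `4 ∣ p − 1` — additive-p2's
  `SubGordHigherOrdinary` dictionary — whence the ORDINARY point of the good model (F-B) and the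
  line (F-A3 `exists_isRamifiedOrdinaryLine_of_goodModel`, bad place from `Addv`);
  **`ClassX4Gord.exists_isRamifiedOrdinaryLine_of_five_le (hX) (hp5) (hpv)`**,
  **`ClassX3Gord.exists_isRamifiedOrdinaryLine_of_five_le`** (p10's theorems for `e = 2` BY NAME,
  this row for `e ≠ 2`); **`ClassX4Gord.isRamifiedOrdinaryLine_exists (hX) (hpv)`**,
  **`ClassX3Gord.isRamifiedOrdinaryLine_exists (hp2) (hX) (hpv)`** — NO defect and NO `5 ≤ p`
  binder: at `p = 3` (G) forces `e = 2` (additive-p2's `semistabilityIndex_eq_two_of_typeG_three`).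

Net: the per-pair binder "`∃ L, IsRamifiedOrdinaryLine W p L`" of Route G's EPW consumers
(`ClassX4Gord.mainConjecture_of_katoHalf_of_coeffCert_of_epw`, cc-typer-1's
`congruentLambdaShift_of_epw`) is a THEOREM on the WHOLE of X4♯(G-ord) and X3♯(G-ord) (every odd
`p`, every defect). NOT claimed: uniqueness of the line on `e ∈ {3,4,6}` (cc-typer-2 sequel S1), the
R-D / Kummer identification there (`RamifiedLineKummerEqAt`: typed A239 over the tame field, sequel
S2 + p05's T-RD-E346 located gap), the line-RESPECTING `E[p] ≅ E₁[p]` and `Σ₀` of the EPW transfer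
(per pair), (M) rows (p07's files), `p = 2`. X4♯(G-ord)/X3♯(G-ord) stay CONSTRUCTION-SHAPED.

References: M. Emerton, R. Pollack, T. Weston, Invent. Math. 163 (2006) §3.1 (arXiv:math/0404484
p. 17) [EmertonPollackWeston2006]; J.-P. Serre, J. Tate, Ann. of Math. 88 (1968) §2
[SerreTate1968]; R. Greenberg, LNM 1716 (1999) §1 p. 62, §2 pp. 62–63, 69 [GreenbergLNM1716];
J. H. Silverman, *AEC* VII.5.5, V.4.1(a), VII.7.1, *ATAEC* IV §9 Table 4.1 [SilvermanAEC2009];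
D. Delbourgo, Compositio Math. 113 (1998) §1.2 Lemma (iv), §1.5; cells/n1011/skel/T-ROL-G.md
(fa05b6d488a62a53); class-closure/N10/WEEK-2026-08-28-INPUT-typer2.md §2/§3/§5.
-/

noncomputable section

open scoped Classical NNReal NumberField

open WeierstrassCurve

universe u

namespace Summit.BirchSwinnertonDyer.Rank1Residual.Additive.GoodModelLine

open NumberField IsDedekindDomain Field IsDedekindDomain.HeightOneSpectrum
  Literature.NumberTheory.GaloisRepresentations Literature.NumberTheory.EllipticCurves
  Literature.NumberTheory.EllipticCurves.GreenbergSelmer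
  Literature.NumberTheory.EllipticCurves.EmertonPollackWeston2006
  Literature.NumberTheory.EllipticCurves.Rank1Residual
  Literature.NumberTheory.EllipticCurves.Rank1Residual.Typed
  Summit.BirchSwinnertonDyer.Rank1Residual.X2.GreenbergVatsalReductionDatum

variable (W : WeierstrassCurve ℚ) [W.IsElliptic] (p : ℕ) [hp : Fact p.Prime]
  {v : HeightOneSpectrum (𝓞 ℚ)}

/-! ## §3 The ramified ordinary line on the (G-ord) rows with `e ∈ {3, 4, 6}` -/

variable [W.IsGloballyMinimal]

omit [W.IsElliptic] [W.IsGloballyMinimal] in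
/-- The place `v ∋ p` of `ℚ` is the census's place `primesEquiv.symm p`. [folklore] -/
theorem eq_primesEquiv_symm (hpv : ((p : ℕ) : 𝓞 ℚ) ∈ v.asIdeal) :
    v = (Rat.HeightOneSpectrum.primesEquiv (R := 𝓞 ℚ)).symm ⟨p, hp.out⟩ := by
  rw [Equiv.eq_symm_apply]
  exact Subtype.ext (Rat.HeightOneSpectrum.primesEquiv_eq_of_natCast_mem v hp.out hpv)

/-- **THE RAMIFIED ORDINARY LINE ON (G-ord) ROWS WITH `e ∈ {3, 4, 6}`** (`p ≥ 5`): for `E/ℚ`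
globally minimal, ADDITIVE at `p`, of Delbourgo type (G) with ordinary reduction (`TypeGOrd W p`,
equivalently potentially good ordinary) and semistability defect `e_E(p) ≠ 2`, at the place
`v ∋ p`: `∃ L, IsRamifiedOrdinaryLine W p L`. Construction: a good model `W₀` over `𝒪_w ⊂ K̄_v`
(Deuring, `ord_p j ≥ 0` from (G)); `e ∈ {3, 6}` forces `j̃ = 0` and `3 ∣ p − 1`, `e = 4` forces
`j̃ = 1728` and `4 ∣ p − 1` (`e ∣ p − 1` from (G), additive-p2's `SubGordHigherOrdinary` data), so
the reduced curve is ORDINARY (F-B); then F-A's `exists_isRamifiedOrdinaryLine_of_goodModel` with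
`¬ good at v` from additivity. No twist model, no named fact; `e = 2` is p10's
`ClassX4Gord.exists_isRamifiedOrdinaryLine` (by name, below).
[cite: EmertonPollackWeston2006, §3.1 (eq:ordes) (arXiv:math/0404484 p. 17)]
[cite: SerreTate1968, §2 Thm. 2 and Cor. 2] [cite: GreenbergLNM1716, §1 p. 62 and §2 p. 63]
[cite: SilvermanAEC2009, Prop. VII.5.5, Thm. V.4.1(a), Thm. VII.7.1] -/
theorem exists_isRamifiedOrdinaryLine_of_typeGOrd_of_semistabilityIndex_ne_two (hp5 : 5 ≤ p)
    (hG : TypeGOrd W p) (hadd : Addv W p) (he : semistabilityIndex W p ≠ 2)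
    (hpv : ((p : ℕ) : 𝓞 ℚ) ∈ v.asIdeal) :
    ∃ Lv : LocalDatum ℚ (W.geomPrimaryTorsion p) v, IsRamifiedOrdinaryLine W p Lv := by
  have hp3 : p ≠ 3 := by omega
  -- data from (G)
  have hj : 0 ≤ padicValRat p W.j := padicValRat_j_nonneg_of_typeGOrd W p hG
  have hedvd : semistabilityIndex W p ∣ p - 1 :=
    ((typeG_iff_not_subM_and_semistabilityIndex_dvd W p hp5).mp hG.typeG).2
  have he12 := semistabilityIndex_dvd_twelve W p
  have he1 := semistabilityIndex_ne_one_of_addv W p hp5 hadd hj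
  have hecase : semistabilityIndex W p = 3 ∨ semistabilityIndex W p = 4 ∨ semistabilityIndex W p = 6 ∨
      semistabilityIndex W p = 12 := by
    have hle : semistabilityIndex W p ≤ 12 := Nat.le_of_dvd (by norm_num) he12
    interval_cases h : semistabilityIndex W p <;> omega
  -- the good model and the bad place
  obtain ⟨C, W₀, hW₀, hΔ⟩ := exists_goodModel_of_padicValRat_j_nonneg W p hpv hp3 hj
  have hbad : ¬ W.HasGoodReductionAt v := by
    rw [eq_primesEquiv_symm p hpv]
    exact (hasAdditiveReductionAt_of_addv W p hadd).not_hasGoodReductionAt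
  haveI := charP_residueField_specVal p hpv
  -- the ordinary point
  have hord : ∃ P : (W₀.baseChange (AlgebraicClosure (v.adicCompletion ℚ))).toAffine.Point,
      (p : ℤ) • P = 0 ∧ goodReductionHom W₀ (Valuation.integer.integers (specVal v)) hΔ P ≠ 0 := by
    by_cases h3e : 3 ∣ semistabilityIndex W p
    · -- `j̃ = 0`, `3 ∣ p − 1`
      have h3v : ¬ 3 ∣ padicValInt p W.minimalDiscriminantInt := by
        intro h
        have : 3 ∣ 4 := dvd_trans h3e (semistabilityIndex_dvd_four_of_three_dvd W p h)
        omega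
      exact exists_torsion_goodReductionHom_ne_zero_of_residue_c₄_eq_zero
        (O := (specVal v).valuationSubring) (Valuation.integer.integers (specVal v)) hΔ p hp5
        (dvd_trans h3e hedvd)
        (residue_c₄_eq_zero_of_goodModel W p hpv hW₀ hΔ
          (j_eq_zero_or_padicValRat_j_pos_of_not_three_dvd W p hj h3v))
    · -- `e = 4`: `j̃ = 1728`, `4 ∣ p − 1`
      have h4e : 4 ∣ semistabilityIndex W p := by
        rcases hecase with h | h | h | h <;> rw [h] at h3e ⊢ <;> omega
      have h2v : ¬ 2 ∣ padicValInt p W.minimalDiscriminantInt := by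
        intro h
        have : 4 ∣ 6 := dvd_trans h4e (semistabilityIndex_dvd_six_of_two_dvd W p h)
        omega
      exact exists_torsion_goodReductionHom_ne_zero_of_residue_c₆_eq_zero
        (O := (specVal v).valuationSubring) (Valuation.integer.integers (specVal v)) hΔ p hp5
        (dvd_trans h4e hedvd)
        (residue_c₆_eq_zero_of_goodModel W p hpv hW₀ hΔ
          (j_eq_or_padicValRat_j_sub_pos_of_not_two_dvd W p hp5 hj h2v))
  obtain ⟨Lv, hLv, -⟩ := exists_isRamifiedOrdinaryLine_of_goodModel W p hW₀ hΔ hord hpv hbad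
  exact ⟨Lv, hLv⟩

variable {W p}

/-- **X4♯(G-ord), EVERY semistability defect, `p ≥ 5`: the ramified ordinary line EXISTS** — p10's
`ClassX4Gord.exists_isRamifiedOrdinaryLine` (p259355) WITHOUT its binder
`he : semistabilityIndex W p = 2`: `e = 2` by p10's theorem (Greenberg's line of the good-ordinary
twist model, twisted back), `e ∈ {3, 4, 6}` by the good-model construction of this row. The
per-pair binder "ramified ordinary line at `E`" of Route G's EPW consumers is a theorem on the
WHOLE class X4♯(G-ord) at `p ≥ 5` (at `p = 3`, `TypeGOrd` forces `e = 2`: p10's theorem). X4♯(G-ord)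
stays CONSTRUCTION-SHAPED; nothing booked. [cite: EmertonPollackWeston2006, §3.1 (eq:ordes) (arXiv:math/0404484 p. 17)]
[cite: GreenbergLNM1716, §2 pp. 62–63 and p. 69] [cite: SerreTate1968, §2 Thm. 2 and Cor. 2] -/
theorem ClassX4Gord.exists_isRamifiedOrdinaryLine_of_five_le (hX : ClassX4Gord W p) (hp5 : 5 ≤ p)
    (hpv : ((p : ℕ) : 𝓞 ℚ) ∈ v.asIdeal) :
    ∃ L : LocalDatum ℚ (W.geomPrimaryTorsion p) v, IsRamifiedOrdinaryLine W p L := by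
  by_cases he : semistabilityIndex W p = 2
  · exact ClassX4Gord.exists_isRamifiedOrdinaryLine hX he hpv
  · exact exists_isRamifiedOrdinaryLine_of_typeGOrd_of_semistabilityIndex_ne_two W p hp5 hX.typeGOrd
      hX.addv.2 he hpv

/-- **X3♯(G-ord), EVERY semistability defect, `p ≥ 5`: the ramified ordinary line EXISTS** — p10's
`ClassX3Gord.exists_isRamifiedOrdinaryLine` WITHOUT `he`. X3♯(G-ord) stays as labelled; nothing
booked. [cite: EmertonPollackWeston2006, §3.1 (eq:ordes) (arXiv:math/0404484 p. 17)]
[cite: GreenbergLNM1716, §2 pp. 62–63 and p. 69] [cite: SerreTate1968, §2 Thm. 2 and Cor. 2] -/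
theorem ClassX3Gord.exists_isRamifiedOrdinaryLine_of_five_le (hX : ClassX3Gord W p) (hp5 : 5 ≤ p)
    (hpv : ((p : ℕ) : 𝓞 ℚ) ∈ v.asIdeal) :
    ∃ L : LocalDatum ℚ (W.geomPrimaryTorsion p) v, IsRamifiedOrdinaryLine W p L := by
  have hp2 : p ≠ 2 := by omega
  by_cases he : semistabilityIndex W p = 2
  · exact ClassX3Gord.exists_isRamifiedOrdinaryLine hp2 hX he hpv
  · exact exists_isRamifiedOrdinaryLine_of_typeGOrd_of_semistabilityIndex_ne_two W p hp5 hX.typeGOrd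
      hX.addv he hpv

/-- **X4♯(G-ord) at EVERY odd prime, NO defect binder: the ramified ordinary line EXISTS.** At
`p = 3` Delbourgo's (G) forces `e_E(3) = 2` (additive-p2's `semistabilityIndex_eq_two_of_typeG_three`:
the `3 ∣ e` types are potentially supersingular), so p10's twist-model theorem applies; at `p ≥ 5`
`ClassX4Gord.exists_isRamifiedOrdinaryLine_of_five_le`. This is the `∃ L, IsRamifiedOrdinaryLine W p L`
binder of Route G's EPW consumers as a theorem on ALL of X4♯(G-ord) (`p` odd is part of `ClassX4`).
X4♯(G-ord) stays CONSTRUCTION-SHAPED; nothing booked.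
[cite: EmertonPollackWeston2006, §3.1 (eq:ordes) (arXiv:math/0404484 p. 17)]
[cite: GreenbergLNM1716, §2 pp. 62–63 and p. 69] [cite: SerreTate1968, §2 Thm. 2 and Cor. 2] -/
theorem ClassX4Gord.isRamifiedOrdinaryLine_exists (hX : ClassX4Gord W p)
    (hpv : ((p : ℕ) : 𝓞 ℚ) ∈ v.asIdeal) :
    ∃ L : LocalDatum ℚ (W.geomPrimaryTorsion p) v, IsRamifiedOrdinaryLine W p L := by
  have hp2 : p ≠ 2 := hX.addv.1
  by_cases hp3 : p = 3
  · subst hp3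
    exact ClassX4Gord.exists_isRamifiedOrdinaryLine hX
      (semistabilityIndex_eq_two_of_typeG_three W hX.typeGOrd.typeG hX.addv.2) hpv
  · have hp5 : 5 ≤ p := by
      have h2 := hp.out.two_le
      rcases Nat.lt_or_ge p 5 with h | h
      · interval_cases p
        · exact absurd rfl hp2
        · exact absurd rfl hp3
        · exact absurd hp.out (by decide)
      · exact h
    exact ClassX4Gord.exists_isRamifiedOrdinaryLine_of_five_le hX hp5 hpv

/-- **X3♯(G-ord) at EVERY odd prime, NO defect binder: the ramified ordinary line EXISTS**
(`p = 3`: `e = 2` forced, p10; `p ≥ 5`: `ClassX3Gord.exists_isRamifiedOrdinaryLine_of_five_le`).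
X3♯(G-ord) stays as labelled; nothing booked.
[cite: EmertonPollackWeston2006, §3.1 (eq:ordes) (arXiv:math/0404484 p. 17)]
[cite: GreenbergLNM1716, §2 pp. 62–63 and p. 69] [cite: SerreTate1968, §2 Thm. 2 and Cor. 2] -/
theorem ClassX3Gord.isRamifiedOrdinaryLine_exists (hp2 : p ≠ 2) (hX : ClassX3Gord W p)
    (hpv : ((p : ℕ) : 𝓞 ℚ) ∈ v.asIdeal) :
    ∃ L : LocalDatum ℚ (W.geomPrimaryTorsion p) v, IsRamifiedOrdinaryLine W p L := by
  by_cases hp3 : p = 3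
  · subst hp3
    exact ClassX3Gord.exists_isRamifiedOrdinaryLine hp2 hX
      (semistabilityIndex_eq_two_of_typeG_three W hX.typeGOrd.typeG hX.addv) hpv
  · have hp5 : 5 ≤ p := by
      have h2 := hp.out.two_le
      rcases Nat.lt_or_ge p 5 with h | h
      · interval_cases p
        · exact absurd rfl hp2
        · exact absurd rfl hp3
        · exact absurd hp.out (by decide)
      · exact h
    exact ClassX3Gord.exists_isRamifiedOrdinaryLine_of_five_le hX hp5 hpv

/-! ## §4 With cc-typer-2's model-free uniqueness: EXACTLY ONE ramified ordinary line -/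

/-- **X4♯(G-ord), every odd `p`: there is EXACTLY ONE ramified ordinary line at `v ∋ p`** —
existence (`ClassX4Gord.isRamifiedOrdinaryLine_exists`, this row) with cc-typer-2's model-free
uniqueness `IsRamifiedOrdinaryLine.eq_of_isRamifiedOrdinaryLine` (p280951, Weil pairing: inertia
acts on any ramified ordinary line through the cyclotomic character). So every `∀ L`- and every
`∃ L`-phrased binder over `IsRamifiedOrdinaryLine W p L` on X4♯(G-ord) refers to the same object —
Coates' canonical subgroup / EPW's `A'_{f̃,a}` / the good-model line `E[p^∞] ∩ ker(red_{W₀} ∘ Φ_C)`.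
[cite: CoatesLNM1716, p. 31 (62) (the canonical subgroup C)] [cite: GreenbergVatsal2000, §2 p. 26]
[cite: EmertonPollackWeston2006, §3.1 (eq:ordes) (arXiv:math/0404484 p. 17)] -/
theorem ClassX4Gord.existsUnique_isRamifiedOrdinaryLine (hX : ClassX4Gord W p)
    (hpv : ((p : ℕ) : 𝓞 ℚ) ∈ v.asIdeal) :
    ∃! L : LocalDatum ℚ (W.geomPrimaryTorsion p) v, IsRamifiedOrdinaryLine W p L := by
  obtain ⟨L, hL⟩ := ClassX4Gord.isRamifiedOrdinaryLine_exists hX hpv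
  exact ⟨L, hL, fun L' hL' ↦ hL'.eq_of_isRamifiedOrdinaryLine hL hpv⟩

/-- **X3♯(G-ord), every odd `p`: there is EXACTLY ONE ramified ordinary line at `v ∋ p`.**
[cite: CoatesLNM1716, p. 31 (62) (the canonical subgroup C)] [cite: GreenbergVatsal2000, §2 p. 26]
[cite: EmertonPollackWeston2006, §3.1 (eq:ordes) (arXiv:math/0404484 p. 17)] -/
theorem ClassX3Gord.existsUnique_isRamifiedOrdinaryLine (hp2 : p ≠ 2) (hX : ClassX3Gord W p)
    (hpv : ((p : ℕ) : 𝓞 ℚ) ∈ v.asIdeal) :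
    ∃! L : LocalDatum ℚ (W.geomPrimaryTorsion p) v, IsRamifiedOrdinaryLine W p L := by
  obtain ⟨L, hL⟩ := ClassX3Gord.isRamifiedOrdinaryLine_exists hp2 hX hpv
  exact ⟨L, hL, fun L' hL' ↦ hL'.eq_of_isRamifiedOrdinaryLine hL hpv⟩

end Summit.BirchSwinnertonDyer.Rank1Residual.Additive.GoodModelLine

end
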